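import Literature.Analysis.Complex.Hurwitz
import Mathlib.Analysis.SpecialFunctions.Complex.Log
import Mathlib.Analysis.SpecialFunctions.Complex.LogDeriv
import Mathlib.Analysis.SpecialFunctions.Complex.LogBounds
import Mathlib.Analysis.Complex.CauchyIntegral
import Summits.HubbardSuperconductivity.HubbardSuperconductivity.Theorems.BalabanIRBirComplexStableXYTwoLevelZero

/-!
# The holomorphic two-level zero lemma
(`BalabanIR.BirComplexStableXY`, stmt-HubbardSuperconductivity-2080, line `theta-rotor-equimodular-zeros`, S3h)

Pure one-complex-variable analysis — the zero-producing step of the Beraha–Kahane–Weiss mechanism in a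
holomorphic parameter; no lattice content.  Let `u` be holomorphic and non-constant on the disc
`ball a₀ ρ` with `‖u a₀‖ = 1`, and let `f M` (`M : ℕ`) be holomorphic on the disc with
`‖f M - 1 - u ^ M‖ ≤ C q ^ M` there for all large `M`, where `0 ≤ q < 1`.  Then `f M` has an exact
zero in the disc for every large `M` (`exists_zero_of_holomorphic_twoLevel`; registered form
`stub_holomorphicTwoLevelZeroLemma`).

Proof.  (1) By the identity principle and continuity there is `r₁ ∈ (0, ρ]` with `u a ≠ u a₀` for
`0 < ‖a - a₀‖ < r₁` and `s < ‖u a‖ < 2` on `ball a₀ r₁`, where `s := (1 + q)/2 ∈ (q, 1)`; put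
`r := r₁ / 2`.  (2) For large `M` the ratio `w := (f M - 1 - u^M) / u^M` has norm
`≤ C (q/s)^M ≤ 1/2` on `ball a₀ r₁`, so the root `V M := u · exp (log (1 + w) / M)` is holomorphic
there, `f M = 1 + (V M)^M`, and `‖V M - u‖ ≤ 4/M`.  (3) With `u a₀ = exp (i θ₀)` and
`k := round ((M θ₀/π - 1)/2)`, the `M`-th root of `-1` `ζ M := exp ((2k+1)π i/M)` satisfies
`‖ζ M - u a₀‖ ≤ 2(π+1)/M`.  (4) Hence `V M - ζ M → u - u a₀` uniformly on `closedBall a₀ r`, the limit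
vanishes at `a₀` and nowhere on `sphere a₀ r`, and the tree's Hurwitz theorem
(`Complex.eventually_exists_zero_mem_ball_of_tendstoUniformlyOn`) gives, for all large `M`, a point
`a ∈ ball a₀ r` with `V M a = ζ M`, i.e. `f M a = 1 + (ζ M)^M = 0`.
No definitions, no named facts.
-/

namespace Summit.HubbardSuperconductivity.BirComplexStableXYNegative

open scoped Real Topology
open Filter Metric Set Complex

/-- Root extraction: for `x ≠ 0`, `M ≠ 0` and `‖y / x^M‖ ≤ 1/2`, the number
`x · exp (log (1 + y/x^M) / M)` is an `M`-th root of `x^M + y`. -/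
theorem holoBKW_root_pow {M : ℕ} (hM : M ≠ 0) {x y : ℂ} (hx : x ≠ 0) (hy : ‖y / x ^ M‖ ≤ 1 / 2) :
    (x * Complex.exp (Complex.log (1 + y / x ^ M) / (M : ℂ))) ^ M = x ^ M + y := by
  have hM0 : (M : ℂ) ≠ 0 := Nat.cast_ne_zero.mpr hM
  have hxM : x ^ M ≠ 0 := pow_ne_zero _ hx
  have hslit : 1 + y / x ^ M ∈ slitPlane := mem_slitPlane_of_norm_lt_one (by linarith)
  rw [mul_pow, ← Complex.exp_nat_mul, mul_div_cancel₀ _ hM0,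
    Complex.exp_log (slitPlane_ne_zero hslit), mul_add, mul_one, mul_div_cancel₀ _ hxM]

/-- The extracted root is `2‖x‖/M`-close to `x`: for `1 ≤ M` and `‖y / x^M‖ ≤ 1/2`,
`‖x · exp (log (1 + y/x^M) / M) - x‖ ≤ ‖x‖ · (2/M)`. -/
theorem holoBKW_root_norm_sub {M : ℕ} (hM : 1 ≤ M) (x y : ℂ) (hy : ‖y / x ^ M‖ ≤ 1 / 2) :
    ‖x * Complex.exp (Complex.log (1 + y / x ^ M) / (M : ℂ)) - x‖ ≤ ‖x‖ * (2 / M) := by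
  have hMpos : (0 : ℝ) < M := by exact_mod_cast hM
  have hL : ‖Complex.log (1 + y / x ^ M)‖ ≤ 1 := norm_log_one_add_le_one hy
  have hLM : ‖Complex.log (1 + y / x ^ M) / (M : ℂ)‖ ≤ 1 / M := by
    rw [norm_div, Complex.norm_natCast]
    exact div_le_div_of_nonneg_right hL hMpos.le
  have h1M : (1 : ℝ) / M ≤ 1 := by
    rw [div_le_one hMpos]
    exact_mod_cast hM
  rw [← mul_sub_one, norm_mul]
  gcongr
  calc ‖Complex.exp (Complex.log (1 + y / x ^ M) / (M : ℂ)) - 1‖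
        ≤ 2 * ‖Complex.log (1 + y / x ^ M) / (M : ℂ)‖ := Complex.norm_exp_sub_one_le (hLM.trans h1M)
    _ ≤ 2 * (1 / M) := by gcongr
    _ = 2 / M := by ring

/-- Holomorphy of the extracted root `a ↦ u a · exp (log (1 + (g a - 1 - (u a)^M)/(u a)^M) / M)` on a
set where `u ≠ 0` and the remainder ratio has norm `≤ 1/2`. -/
theorem holoBKW_root_differentiableOn {U : Set ℂ} {u g : ℂ → ℂ} {M : ℕ}
    (hu : DifferentiableOn ℂ u U) (hg : DifferentiableOn ℂ g U) (hu0 : ∀ a ∈ U, u a ≠ 0)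
    (hsmall : ∀ a ∈ U, ‖(g a - 1 - (u a) ^ M) / (u a) ^ M‖ ≤ 1 / 2) :
    DifferentiableOn ℂ (fun a => u a * Complex.exp
      (Complex.log (1 + (g a - 1 - (u a) ^ M) / (u a) ^ M) / (M : ℂ))) U := by
  have huM : DifferentiableOn ℂ (fun a => (u a) ^ M) U := hu.fun_pow M
  have hw : DifferentiableOn ℂ (fun a => (g a - 1 - (u a) ^ M) / (u a) ^ M) U :=
    ((hg.sub_const 1).fun_sub huM).fun_div huM fun a ha => pow_ne_zero _ (hu0 a ha)
  have hslit : ∀ a ∈ U, 1 + (g a - 1 - (u a) ^ M) / (u a) ^ M ∈ slitPlane := fun a ha =>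
    mem_slitPlane_of_norm_lt_one (by linarith [hsmall a ha])
  exact hu.fun_mul (((hw.const_add 1).clog hslit).div_const _).cexp

/-- **Holomorphic two-level zero lemma** (Beraha–Kahane–Weiss zeros in a holomorphic parameter).
Let `u` be holomorphic and non-constant on `ball a₀ ρ` with `‖u a₀‖ = 1`, and let the holomorphic
functions `f M` satisfy `‖f M - 1 - u^M‖ ≤ C q^M` on the ball for all large `M`, with `0 ≤ q < 1`.
Then `f M` has a zero in `ball a₀ ρ` for every large `M`. -/
theorem exists_zero_of_holomorphic_twoLevel (u : ℂ → ℂ) (f : ℕ → ℂ → ℂ) (a₀ : ℂ) {ρ C q : ℝ}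
    (hρ : 0 < ρ) (hq0 : 0 ≤ q) (hq1 : q < 1) (hu : DifferentiableOn ℂ u (ball a₀ ρ))
    (hnorm : ‖u a₀‖ = 1) (hnc : ∃ a ∈ ball a₀ ρ, u a ≠ u a₀)
    (hf : ∀ M : ℕ, DifferentiableOn ℂ (f M) (ball a₀ ρ))
    (happrox : ∃ M₁ : ℕ, ∀ M : ℕ, M₁ ≤ M → ∀ a ∈ ball a₀ ρ,
      ‖f M a - 1 - (u a) ^ M‖ ≤ C * q ^ M) :
    ∃ M₀ : ℕ, ∀ M : ℕ, M₀ ≤ M → ∃ a ∈ ball a₀ ρ, f M a = 0 := by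
  obtain ⟨M₁, hM₁⟩ := happrox
  -- Step 1: a good radius `r₁` (and `r := r₁ / 2`)
  obtain ⟨s, hqs, hs1⟩ : ∃ s : ℝ, q < s ∧ s < 1 := ⟨(1 + q) / 2, by linarith, by linarith⟩
  have hs0 : 0 < s := lt_of_le_of_lt hq0 hqs
  have ha₀ : a₀ ∈ ball a₀ ρ := mem_ball_self hρ
  have han : AnalyticOnNhd ℂ u (ball a₀ ρ) := hu.analyticOnNhd isOpen_ball
  have hcont : ContinuousAt u a₀ := (han a₀ ha₀).continuousAt
  have hiso : ∀ᶠ a in 𝓝[≠] a₀, u a ≠ u a₀ := by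
    rcases (han a₀ ha₀).eventually_eq_or_eventually_ne analyticAt_const with h | h
    · exfalso
      obtain ⟨a, ha, hne⟩ := hnc
      exact hne (han.eqOn_of_preconnected_of_eventuallyEq analyticOnNhd_const
        (convex_ball a₀ ρ).isPreconnected ha₀ h ha)
    · exact h
  have hgt : ∀ᶠ a in 𝓝 a₀, s < ‖u a‖ :=
    Filter.Tendsto.eventually_const_lt (show s < ‖u a₀‖ by rw [hnorm]; exact hs1) hcont.norm
  have hlt : ∀ᶠ a in 𝓝 a₀, ‖u a‖ < 2 :=
    Filter.Tendsto.eventually_lt_const (show ‖u a₀‖ < 2 by rw [hnorm]; norm_num) hcont.norm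
  have hballev : ∀ᶠ a in 𝓝 a₀, a ∈ ball a₀ ρ := isOpen_ball.mem_nhds ha₀
  have hall : ∀ᶠ a in 𝓝 a₀, (a ≠ a₀ → u a ≠ u a₀) ∧ a ∈ ball a₀ ρ ∧ s < ‖u a‖ ∧ ‖u a‖ < 2 :=
    (eventually_nhdsWithin_iff.1 hiso).and (hballev.and (hgt.and hlt))
  obtain ⟨r₁, hr₁, hB⟩ := Metric.eventually_nhds_iff_ball.1 hall
  obtain ⟨r, hr, hrr₁⟩ : ∃ r : ℝ, 0 < r ∧ r < r₁ := ⟨r₁ / 2, by positivity, by linarith⟩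
  have hsub : closedBall a₀ r ⊆ ball a₀ r₁ := closedBall_subset_ball hrr₁
  have hBρ : ball a₀ r₁ ⊆ ball a₀ ρ := fun a ha => (hB a ha).2.1
  have hu0 : ∀ a ∈ ball a₀ r₁, u a ≠ 0 := fun a ha h0 => by
    have h := (hB a ha).2.2.1
    rw [h0, norm_zero] at h
    linarith
  -- Step 2: large `M`
  have hqs1 : q / s < 1 := (div_lt_one hs0).2 hqs
  have hqs0 : 0 ≤ q / s := div_nonneg hq0 hs0.le
  have htend : Tendsto (fun M : ℕ => C * (q / s) ^ M) atTop (𝓝 0) := by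
    have h := (tendsto_pow_atTop_nhds_zero_of_lt_one hqs0 hqs1).const_mul C
    rwa [mul_zero] at h
  have hev₁ : ∀ᶠ M : ℕ in atTop, C * (q / s) ^ M ≤ 1 / 2 :=
    Filter.Tendsto.eventually_le_const (show (0 : ℝ) < 1 / 2 by norm_num) htend
  have hev₂ : ∀ᶠ M : ℕ in atTop, (π + 1) / (M : ℝ) ≤ 1 :=
    Filter.Tendsto.eventually_le_const one_pos (tendsto_const_div_atTop_nhds_zero_nat (π + 1))
  obtain ⟨M₂, hM₂⟩ := Filter.eventually_atTop.1
    ((eventually_ge_atTop M₁).and ((eventually_ge_atTop 1).and (hev₁.and hev₂)))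
  -- the remainder ratio is small on `ball a₀ r₁`
  have hw : ∀ M, M₂ ≤ M → ∀ a ∈ ball a₀ r₁,
      ‖(f M a - 1 - (u a) ^ M) / (u a) ^ M‖ ≤ 1 / 2 := by
    intro M hM a ha
    obtain ⟨hMM₁, -, hC, -⟩ := hM₂ M hM
    have hsa : s < ‖u a‖ := (hB a ha).2.2.1
    have huM : 0 < ‖u a‖ ^ M := pow_pos (hs0.trans hsa) M
    rw [norm_div, norm_pow, div_le_iff₀ huM]
    calc ‖f M a - 1 - (u a) ^ M‖ ≤ C * q ^ M := hM₁ M hMM₁ a (hBρ ha)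
      _ = C * (q / s) ^ M * s ^ M := by
        rw [div_pow, mul_assoc, div_mul_cancel₀ _ (pow_ne_zero M hs0.ne')]
      _ ≤ 1 / 2 * s ^ M := mul_le_mul_of_nonneg_right hC (pow_nonneg hs0.le M)
      _ ≤ 1 / 2 * ‖u a‖ ^ M := by gcongr
  -- the extracted root `V M`
  obtain ⟨V, hV⟩ : ∃ V : ℕ → ℂ → ℂ, ∀ M a, V M a =
      u a * Complex.exp (Complex.log (1 + (f M a - 1 - (u a) ^ M) / (u a) ^ M) / (M : ℂ)) :=
    ⟨_, fun _ _ => rfl⟩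
  have hVf : ∀ M, M₂ ≤ M → ∀ a ∈ ball a₀ r₁, f M a = 1 + (V M a) ^ M := by
    intro M hM a ha
    obtain ⟨-, hM1, -, -⟩ := hM₂ M hM
    rw [hV, holoBKW_root_pow (by omega) (hu0 a ha) (hw M hM a ha)]
    ring
  have hVsub : ∀ M, M₂ ≤ M → ∀ a ∈ ball a₀ r₁, ‖V M a - u a‖ ≤ 4 / M := by
    intro M hM a ha
    obtain ⟨-, hM1, -, -⟩ := hM₂ M hM
    have hMpos : (0 : ℝ) < M := by exact_mod_cast hM1
    rw [hV]
    calc ‖u a * Complex.exp (Complex.log (1 + (f M a - 1 - (u a) ^ M) / (u a) ^ M) / (M : ℂ)) - u a‖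
          ≤ ‖u a‖ * (2 / M) := holoBKW_root_norm_sub hM1 _ _ (hw M hM a ha)
      _ ≤ 2 * (2 / M) := mul_le_mul_of_nonneg_right (hB a ha).2.2.2.le (by positivity)
      _ = 4 / M := by ring
  have hVdiff : ∀ M, M₂ ≤ M → DifferentiableOn ℂ (V M) (ball a₀ r₁) := by
    intro M hM
    have hVM : V M = fun a =>
        u a * Complex.exp (Complex.log (1 + (f M a - 1 - (u a) ^ M) / (u a) ^ M) / (M : ℂ)) :=
      funext (hV M)
    rw [hVM]
    exact holoBKW_root_differentiableOn (hu.mono hBρ) ((hf M).mono hBρ) hu0 (hw M hM)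
  -- Step 3: the moving targets `ζ M`, `M`-th roots of `-1` close to `u a₀ = exp (i θ₀)`
  obtain ⟨θ₀, hθ₀⟩ : ∃ θ₀ : ℝ, Complex.exp ((θ₀ : ℂ) * I) = u a₀ :=
    ⟨Complex.arg (u a₀), by
      have h := Complex.norm_mul_exp_arg_mul_I (u a₀)
      rwa [hnorm, Complex.ofReal_one, one_mul] at h⟩
  obtain ⟨ζ, hζ⟩ : ∃ ζ : ℕ → ℂ, ∀ M, ζ M = Complex.exp
      ((((2 * ((round (((M : ℝ) * θ₀ / π - 1) / 2) : ℤ) : ℝ) + 1) * π : ℝ) : ℂ) * I / (M : ℂ)) :=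
    ⟨_, fun _ => rfl⟩
  have hζpow : ∀ M : ℕ, M ≠ 0 → (ζ M) ^ M = -1 := by
    intro M hM
    have hM0 : (M : ℂ) ≠ 0 := Nat.cast_ne_zero.mpr hM
    rw [hζ, ← Complex.exp_nat_mul, mul_div_cancel₀ _ hM0, exp_odd_mul_pi_mul_I]
  have hζsub : ∀ M : ℕ, (0 : ℝ) < M → (π + 1) / (M : ℝ) ≤ 1 →
      ‖ζ M - u a₀‖ ≤ 2 * ((π + 1) / M) := by
    intro M hMpos hMπ
    have h := norm_exp_div_sub_exp_le hMpos (abs_odd_mul_pi_div_sub_le hMpos θ₀)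
      (show ‖(0 : ℂ)‖ ≤ 1 by simp) hMπ
    rw [add_zero, hθ₀] at h
    rwa [hζ]
  -- Step 4: Hurwitz's theorem for `V M - ζ M → u - u a₀` on `closedBall a₀ r`
  have hFdiff : ∀ᶠ M in atTop, DiffContOnCl ℂ (fun a => V M a - ζ M) (ball a₀ r) := by
    filter_upwards [eventually_ge_atTop M₂] with M hM
    exact ((hVdiff M hM).sub_const (ζ M)).diffContOnCl_ball hsub
  have hunif : TendstoUniformlyOn (fun M a => V M a - ζ M) (fun a => u a - u a₀) atTop
      (closedBall a₀ r) := by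
    refine Metric.tendstoUniformlyOn_iff.2 fun ε hε => ?_
    have hεev : ∀ᶠ M : ℕ in atTop, (2 * π + 6) / (M : ℝ) < ε :=
      Filter.Tendsto.eventually_lt_const hε (tendsto_const_div_atTop_nhds_zero_nat (2 * π + 6))
    filter_upwards [eventually_ge_atTop M₂, hεev] with M hM hMε a ha
    obtain ⟨-, hM1, -, hMπ⟩ := hM₂ M hM
    have hMpos : (0 : ℝ) < M := by exact_mod_cast hM1
    have hM0 : (M : ℝ) ≠ 0 := hMpos.ne'
    have ha₁ : a ∈ ball a₀ r₁ := hsub ha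
    rw [dist_eq_norm]
    calc ‖u a - u a₀ - (V M a - ζ M)‖ = ‖ζ M - u a₀ - (V M a - u a)‖ := by
          congr 1
          ring
      _ ≤ ‖ζ M - u a₀‖ + ‖V M a - u a‖ := norm_sub_le _ _
      _ ≤ 2 * ((π + 1) / M) + 4 / M := add_le_add (hζsub M hMpos hMπ) (hVsub M hM a ha₁)
      _ = (2 * π + 6) / M := by
          field_simp
          ring
      _ < ε := hMε
  have hgcont : ContinuousOn (fun a => u a - u a₀) (sphere a₀ r) :=
    (hu.continuousOn.mono (sphere_subset_closedBall.trans (hsub.trans hBρ))).fun_sub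
      continuousOn_const
  have hgs : ∀ a ∈ sphere a₀ r, u a - u a₀ ≠ 0 := by
    intro a ha
    have hne : a ≠ a₀ := by
      rintro rfl
      simp only [mem_sphere, dist_self] at ha
      exact hr.ne ha
    exact sub_ne_zero.2 ((hB a (hsub (sphere_subset_closedBall ha))).1 hne)
  have hzero := Complex.eventually_exists_zero_mem_ball_of_tendstoUniformlyOn hr hFdiff hunif hgcont
    (sub_self (u a₀)) hgs
  -- Step 5: conclusion
  obtain ⟨M₀, hM₀⟩ := Filter.eventually_atTop.1 (hzero.and (eventually_ge_atTop M₂))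
  refine ⟨M₀, fun M hM => ?_⟩
  obtain ⟨⟨a, ha, hFa⟩, hMM₂⟩ := hM₀ M hM
  have ha₁ : a ∈ ball a₀ r₁ := hsub (ball_subset_closedBall ha)
  obtain ⟨-, hM1, -, -⟩ := hM₂ M hMM₂
  refine ⟨a, hBρ ha₁, ?_⟩
  have hVa : V M a = ζ M := sub_eq_zero.1 hFa
  rw [hVf M hMM₂ a ha₁, hVa, hζpow M (by omega), add_neg_cancel]

/-- S3h (registered stub): the holomorphic two-level zero lemma.  If `u` is holomorphic and
non-constant on `ball a₀ ρ` with `‖u a₀‖ = 1` and the holomorphic `f M` satisfy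
`‖f M - 1 - u^M‖ ≤ C q^M` (`0 ≤ q < 1`) on the ball for all large `M`, then `f M` has a zero in the
ball for every large `M`. -/
theorem stub_holomorphicTwoLevelZeroLemma :
    ∀ (u : ℂ → ℂ) (f : ℕ → ℂ → ℂ) (a₀ : ℂ) (ρ C q : ℝ),
      0 < ρ → 0 ≤ q → q < 1 →
      DifferentiableOn ℂ u (ball a₀ ρ) → ‖u a₀‖ = 1 → (∃ a ∈ ball a₀ ρ, u a ≠ u a₀) →
      (∀ M : ℕ, DifferentiableOn ℂ (f M) (ball a₀ ρ)) →
      (∃ M₁ : ℕ, ∀ M : ℕ, M₁ ≤ M → ∀ a ∈ ball a₀ ρ, ‖f M a - 1 - (u a) ^ M‖ ≤ C * q ^ M) →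
      ∃ M₀ : ℕ, ∀ M : ℕ, M₀ ≤ M → ∃ a ∈ ball a₀ ρ, f M a = 0 :=
  fun u f a₀ _ _ _ hρ hq0 hq1 hu hnorm hnc hf happrox =>
    exists_zero_of_holomorphic_twoLevel u f a₀ hρ hq0 hq1 hu hnorm hnc hf happrox

end Summit.HubbardSuperconductivity.BirComplexStableXYNegative
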